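import Mathlib
import Summits.ValiantsHypothesis.ValiantsHypothesis.Theorems.BarrierLeverPartitionMinorsHitByVPSimplexJoinBoxGame

/-!
# Route BarrierLever — item `PartitionMinorsHitByVP` (stmt-ValiantsHypothesis-19717), line `hidden_states`:
# THE BOX GAME, FIRST WINNING PREDICATE — single-slot (segment) designs win, end to end through the cut game

Helper file (`--supports stmt-ValiantsHypothesis-19717`; cell valiant-natproofs, rung V4, 𝒟-side door (c), line
`Cruxes/PartitionMinorsHitByVP/Lines/hidden_states.lean` v8; prover seat val-np-p3 gen 13). Definition-free. Closes NO item.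

THE POINT. A smoke test of the box-game interface (`Cut.exists_simplexTable_of_boxWinning`, p647518): the predicate
«`e` is injective and every piece uses ONE slot» (`f p`; all other slots read `none`) WINS THE BOX GAME — any demanded number `r₁` of columns
can be coloured `true` by colouring their (pairwise distinct) values at the piece's slot, and both colour classes are single-slot designs again
(`segments_win`). Consequence (`exists_simplexTable_of_singleSlot_lower`): a single-slot design is good for EVERY injective lower row family —
the down-set half of val-np-p3 g11's `uniform_of_singleSlot` (p621310), re-derived with no linear algebra beyond the cut game. The value is the
ROUTE, not the statement: the same three moves (choose columns, colour their slot values, recurse) are what a winning predicate for deep boxes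
must provide, with the arithmetic of WHICH columns as the only remaining content.

WHAT THIS IS NOT: deep boxes are not treated; item 19717 stays OPEN; nothing on crux 14610 or VP ≠ VNP.
-/

set_option linter.dupNamespace false

namespace Summit.ValiantsHypothesis.ValiantsHypothesis.Theorems.BarrierLever.SimplexJoin.Cut

open Finset Matrix MvPolynomial
open Summit.ValiantsHypothesis.ValiantsHypothesis.Theorems.BarrierLever.HiddenStates

noncomputable section

variable {h m D N : ℕ}

/-- **Single-slot designs win the box game.** The predicate «`e` injective, and some slot assignment `f` with `(e k).2 f' = none`
whenever `f' ≠ f (e k).1`» answers every demand `r₀ + r₁ = r`: colour `true` exactly the slot values of the last `r₁` columns. -/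
theorem segments_win (r : ℕ) (e : Fin r → Fin m × (Fin D → Option (Fin N)))
    (hW : Function.Injective e ∧ ∃ f : Fin m → Fin D, ∀ k f', f' ≠ f (e k).1 → (e k).2 f' = none)
    (r₀ r₁ : ℕ) (hr : r₀ + r₁ = r) :
    ∃ (f : Fin m → Fin D) (side : Fin m → Option (Fin N) → Bool) (g₀ : Fin r₀ → Fin r) (g₁ : Fin r₁ → Fin r),
      Function.Injective (Sum.elim g₀ g₁) ∧
      (∀ j, side (e (g₀ j)).1 ((e (g₀ j)).2 (f (e (g₀ j)).1)) = false) ∧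
      (∀ j, side (e (g₁ j)).1 ((e (g₁ j)).2 (f (e (g₁ j)).1)) = true) ∧
      (Function.Injective (fun j => e (g₀ j)) ∧ ∃ f : Fin m → Fin D, ∀ k f', f' ≠ f (e (g₀ k)).1 → (e (g₀ k)).2 f' = none) ∧
      (Function.Injective (fun j => e (g₁ j)) ∧ ∃ f : Fin m → Fin D, ∀ k f', f' ≠ f (e (g₁ k)).1 → (e (g₁ k)).2 f' = none) := by
  classical
  obtain ⟨he, f, hf⟩ := hW
  subst hr
  -- the last r₁ columns are coloured `true`
  let g₀ : Fin r₀ → Fin (r₀ + r₁) := fun j => Fin.castAdd r₁ j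
  let g₁ : Fin r₁ → Fin (r₀ + r₁) := fun j => Fin.natAdd r₀ j
  let side : Fin m → Option (Fin N) → Bool := fun p o =>
    decide (∃ j : Fin r₁, (e (g₁ j)).1 = p ∧ (e (g₁ j)).2 (f p) = o)
  -- two columns of one piece with the same value at the piece's slot coincide
  have key : ∀ k k', (e k).1 = (e k').1 → (e k).2 (f (e k).1) = (e k').2 (f (e k').1) → k = k' := by
    intro k k' hp hv
    apply he
    refine Prod.ext hp (funext fun f' => ?_)
    by_cases hf' : f' = f (e k).1
    · rw [hf', hv, hp]
    · rw [hf k f' hf', hf k' f' (hp ▸ hf')]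
  have hg : Function.Injective (Sum.elim g₀ g₁) := by
    have : Sum.elim g₀ g₁ = finSumFinEquiv := by
      funext x; rcases x with j | j <;> rfl
    rw [this]; exact finSumFinEquiv.injective
  refine ⟨f, side, g₀, g₁, hg, fun j => ?_, fun j => ?_, ⟨fun a b hab => ?_, f, fun k f' hf' => hf _ f' hf'⟩,
    ⟨fun a b hab => ?_, f, fun k f' hf' => hf _ f' hf'⟩⟩
  · -- an unchosen column whose value were coloured true would coincide with a chosen one
    simp only [side, decide_eq_false_iff_not, not_exists, not_and]
    intro j' hp hv
    have := key (g₁ j') (g₀ j) hp (by rw [hp]; exact hv)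
    have hlt : (g₀ j : ℕ) < r₀ := by simp [g₀]
    have hge : r₀ ≤ (g₁ j' : ℕ) := by simp [g₁]
    rw [this] at hge
    omega
  · simp only [side, decide_eq_true_eq]
    exact ⟨j, rfl, rfl⟩
  · exact Fin.castAdd_injective _ _ (he hab)
  · exact Fin.natAdd_injective _ _ (he hab)

/-- **Single-slot designs are good for every lower row family** — through the box game (`exists_simplexTable_of_boxWinning` with the
winning predicate of `segments_win`). -/
theorem exists_simplexTable_of_singleSlot_lower {r : ℕ} (e : Fin r → Fin m × (Fin D → Option (Fin N)))
    (he : Function.Injective e) (f : Fin m → Fin D) (hf : ∀ k f', f' ≠ f (e k).1 → (e k).2 f' = none)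
    (u : Fin r → Finset (Fin h)) (hu : Function.Injective u) (hlow : IsLowerSet (Set.range u)) :
    ∃ tx : Fin m → Option (Fin D × Fin N) → Fin h → ℂ,
      (Matrix.of fun i k : Fin r => ∏ a ∈ u i,
        (tx (e k).1 none a + ∑ f : Fin D, ((e k).2 f).elim 0 fun j => tx (e k).1 (some (f, j)) a)).det ≠ 0 := by
  refine exists_simplexTable_of_boxWinning
    (fun _ r e => Function.Injective e ∧ ∃ f : Fin m → Fin D, ∀ k f', f' ≠ f (e k).1 → (e k).2 f' = none)
    (fun _ r e hW _ _ r₀ r₁ hr _ _ _ => segments_win r e hW r₀ r₁ hr) e ⟨he, f, hf⟩ u hu hlow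

end

end Summit.ValiantsHypothesis.ValiantsHypothesis.Theorems.BarrierLever.SimplexJoin.Cut
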